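import Summits.BirchSwinnertonDyer.BirchSwinnertonDyer.Theorems.QuadraticBranchSignedControlPlusEtaNonsurjThetaFunctionalEquationOrder
import Mathlib.RingTheory.PowerSeries.Binomial
import Mathlib.NumberTheory.Padics.MahlerBasis
import HarnessLib

/-!
# Route `QuadraticBranchSignedControl` (rung K8, cell `bsd-potss`), residual crux `PlusEtaMainConjectureNonsurj`
# (stmt-BirchSwinnertonDyer-19606): THE FUNCTIONAL EQUATION ON THE QUADRATIC BRANCH, IX — THE EXACT `Λ`-ADIC EQUATION OF THE
# MAZUR–TATE LIMITS with a `p`-ADIC exponent: `ι M⁺ = w·(1+T)^{c+b}·M⁺` (`(p+1)b = −1`), `ι M⁻ = w·(1+T)^{c+a}·M⁻` (`(p+1)a = −p`),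
# `w = σ·(−N | p)`, by passing to the limit in Part V (seat `bsd-potss-k8eta-c2` g28; kernel, class-wide)

WHY. Part V (p761517) proved, for the Mazur–Tate limits `M^±` of the quadratic branch and every `m`, a functional equation MODULO
`T·ω^±_{2m(+1)}·Λ` with an INTEGER exponent depending on `m` (`ι M − w(1+T)^{e_m}M ∈ T·ω⁺_{2m}Λ`, `∃ e_m`). The printed functional
equation of a signed `p`-adic `L`-function at a supersingular prime is an EXACT identity in `Λ = ℤ_p⟦T⟧` with a `p`-ADIC exponent:
Sprung 2017, Cor. 4.14 (which corrects Pollack 2003, Thm. 5.13 by the unit factors `W⁺ = ∏_{j≥1}(1+T)^{−p^{2j−1}(p−1)} = (1+T)^{p/(p+1)}`,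
`W⁻ = ∏_{j≥1}(1+T)^{−p^{2j−2}(p−1)} = (1+T)^{1/(p+1)}`), with the sign `ωⁱ(−N)` on a tame branch (Mazur–Tate–Teitelbaum §I.17). The tree
carries this shape for the TRIVIAL branch as the named fact `Sprung2017.cor414_sharpFlat_functionalEquation_apZero` (`L♯(T^ι) = σ(1+T)^{c+a}L♯`,
`L♭(T^ι) = σ(1+T)^{c+b}L♭`, `(p+1)a = −p`, `(p+1)b = −1`, `c` the `p`-adic exponent of `⟨N⟩`), DISCHARGED for odd `p` by
`Sprung2017.cor414_sharpFlat_functionalEquation_apZero_holds` (`Sprung2017/SharpFlatFunctionalEquationApZeroProofs`: transport of Sprung's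
congruences under `T ↦ T^ι` + UNIQUENESS of the pair) and at `p = 2` by `subst_invOnePlusSubOne_eq_of_isSprungPair_two`. ERRATUM (g28, same
day, docstring only): the first landed text of this file called that fact "unproved" — wrong; it is a tree theorem. THIS FILE proves the η-BRANCH
statement of the same shape for every odd `p`, by a DIFFERENT route (a coefficientwise LIMIT in `Λ`, no uniqueness of the pair needed): with the
`p`-adic exponent `c` of `N` (`N = η_N γ^c`, the tree's `exists_teichmuller_exponent_natCast`) and `w = σ·(−N | p)`:
**`ι M⁺ = w·(1+T)^{c+b}·M⁺` and `ι M⁻ = w·(1+T)^{c+a}·M⁻`**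
(`(1+T)^e = PowerSeries.binomialSeries ℤ_[p] e`; Kobayashi's `+` is Pollack's `−` / Sprung's `♭`, whence `b` on the plus side); Part X
(`…ExactBranch`) transfers this to EVERY `L_p^±(V, η, X)`, with the ideal form `(ι L) = (L)` and the row currency.

MATHEMATICS. (§19) EXPLICIT self-reciprocity exponents: `(1+T)^d·ι(ω⁻_{2m}) = ω⁻_{2m}` with `(p+1)d + 1 = p^{2m}` and
`(1+T)^d·ι(ω⁺_{2m+1}) = ω⁺_{2m+1}` with `(p+1)d + p = p^{2m+1}` (Part IV gave `∃ d`; induction along `ω⁻_{2m+2} = ω⁻_{2m}Φ_{p^{2m+1}}(1+T)`,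
`ω⁺_{2m+3} = ω⁺_{2m+1}Φ_{p^{2m+2}}(1+T)` with `(1+T)^{(p−1)p^k}ιΦ_{p^{k+1}}(1+T) = Φ_{p^{k+1}}(1+T)`), so `d → −1/(p+1)` resp. `−p/(p+1)`
`p`-adically. (§20) Part V's descent with these exponents and the level-`n` discrete logarithm `s_n = c mod pⁿ` of ONE `p`-adic `c`:
`ι M − w(1+T)^{s_{2m}+d_{2m}}M ∈ T·ω⁺_{2m}Λ`. (§21) THE LIMIT (generic `Λ`-lemma): if `ι M − w(1+T)^{e_m}M = D_m` with `coeff_j D_m → 0`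
for every `j` and `e_m → e` in `ℤ_p`, then `ι M = w(1+T)^e M` — each coefficient of `w(1+T)^z M` is a polynomial in the binomial
coefficients `(z choose i)`, CONTINUOUS in `z ∈ ℤ_p` (Mahler; Mathlib `PadicInt.continuous_choose`), and limits in `ℤ_p` are unique;
(§22) here `coeff_j(T·ω⁺_{2m}·G_m) ∈ p^{m−j}ℤ_p` (g26's range lemma) and `‖s_{2m} − c‖, ‖d_{2m} − b‖ ≤ p^{−2m}` (`‖p+1‖ = 1`).

WHAT. §19 `exists_deg_pow_mul_invol_cyclotomicOmega{Minus_two_mul,Plus_two_mul_add_one}`; §20 `exists_invol_mazurTate{Plus,Minus}_sub_sign_mul_eq_explicit`;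
§21 `tendsto_of_norm_sub_le_pow`, `norm_le_pow_of_pow_dvd`, `norm_natCast_add_one`, `le_pow_two_mul_add_one_mul_sub_one`, `norm_natCast_val_toZModPow_sub_le`,
`continuous_coeff_C_mul_binomialSeries_mul`, **`invol_eq_C_mul_binomialSeries_mul_of_tendsto`**; §22 `tendsto_natCast_add_of_level`, **`invol_mazurTate{Plus,Minus}_eq`**.

HONEST FRAMING (cell `bsd-potss`; FULL-BSD rank ≤ 1 programme, HUMAN RULING D-0036/D-0074): TOOL THEOREMS ONLY — no definition, no
named fact (the Fricke sign `σ` and the `p`-adic exponent `c` enter as hypotheses discharged by tree theorems: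
`exists_frickeSign_of_isNewform0`, `exists_teichmuller_exponent_natCast`), no `sorry`, axioms standard; nothing about (A), (C1⁺_η),
C-cc-1 or `BSD(W,p)` of any pair is claimed; no stub of 19606 is proved; crux and route OPEN; nothing booked. Not here: the trivial branch
(the tree theorem `Sprung2017.cor414_sharpFlat_functionalEquation_apZero_holds`). `--supports stmt-BirchSwinnertonDyer-19606`.

References: [Sprung2017] Cor. 4.14 (`a_p = 0` display, `ωⁱ(−N)`) and §3.5 (`W^±`); [Pollack2003] Thm. 5.13, Prop. 6.18;
[MazurTateTeitelbaum1986Invent] §I.17; [GreenbergLNM1716] §1 (pp. 67–68); [Washington1997] §7.1, §13.2. Tree: Parts I–VI, `PlusMinusPAdicLFunctionProofs`,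
`…PlusCoeffCongruenceQuotientRange`, `PAdicLFunctionInvolutionProofs`; Mathlib `PowerSeries.binomialSeries`, `PadicInt.continuous_choose`.
-/

set_option autoImplicit false
set_option linter.dupNamespace false
noncomputable section

open scoped Classical MatrixGroups ModularForm Topology

open Filter CongruenceSubgroup Polynomial Literature.NumberTheory.EllipticCurves
  Literature.NumberTheory.EllipticCurves.ModularForms
open Literature.NumberTheory.EllipticCurves.IwasawaAlgebra
open Summit.BirchSwinnertonDyer.Rank1Residual.Additive

namespace Summit.BirchSwinnertonDyer.BirchSwinnertonDyer.Theorems.EtaThetaFunctionalEquation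

variable {p : ℕ} [hp : Fact p.Prime]

/-! ## §19 Explicit self-reciprocity exponents: `d = deg ω^±`, `(p+1)·deg ω⁻_{2m} + 1 = p^{2m}`, `(p+1)·deg ω⁺_{2m+1} + p = p^{2m+1}` -/

/-- **`(1+T)^d · ι(ω⁻_{2m}) = ω⁻_{2m}` with `(p+1)d + 1 = p^{2m}`** (`d = deg ω⁻_{2m} = Σ_{k=1}^{m}(p−1)p^{2k−2} = (p^{2m}−1)/(p+1)`):
Part IV's self-reciprocity with the exponent made explicit (induction on `m` along `ω⁻_{2m+2} = ω⁻_{2m}·Φ_{p^{2m+1}}(1+T)`).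
[cite: Washington1997, §13.2] [cite: Pollack2003, §6.5 (display before Prop. 6.18)] -/
theorem exists_deg_pow_mul_invol_cyclotomicOmegaMinus_two_mul (m : ℕ) :
    ∃ d : ℕ, (p + 1) * d + 1 = p ^ (2 * m) ∧
      (1 + PowerSeries.X : PowerSeries ℤ_[p]) ^ d *
          invol p (((cyclotomicOmegaMinus p (2 * m)).map (Int.castRingHom ℤ_[p]) : ℤ_[p][X]) : PowerSeries ℤ_[p]) =
        (((cyclotomicOmegaMinus p (2 * m)).map (Int.castRingHom ℤ_[p]) : ℤ_[p][X]) : PowerSeries ℤ_[p]) := by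
  have hP : p.Prime := hp.out
  induction m with
  | zero => exact ⟨0, by simp, by simp [cyclotomicOmegaMinus_zero]⟩
  | succ m ih =>
    obtain ⟨d, hd, hι⟩ := ih
    refine ⟨d + (p - 1) * p ^ (2 * m), ?_, ?_⟩
    · have h1 : 1 ≤ p := hP.one_lt.le
      zify [h1] at hd ⊢
      have e : ((p : ℤ)) ^ (2 * (m + 1)) = (p : ℤ) ^ (2 * m) * p * p := by ring
      rw [e]
      linear_combination hd
    · rw [show 2 * (m + 1) = 2 * m + 2 by ring, cyclotomicOmegaMinus_two_mul_add_two, Polynomial.map_mul, Polynomial.coe_mul,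
        map_mul, pow_add, mul_mul_mul_comm, hι, pow_mul_invol_cyclotomic_comp_X_add_one]

/-- **`(1+T)^d · ι(ω⁺_{2m+1}) = ω⁺_{2m+1}` with `(p+1)d + p = p^{2m+1}`** (`d = deg ω⁺_{2m+1} = Σ_{k=1}^{m}(p−1)p^{2k−1} = p(p^{2m}−1)/(p+1)`;
induction along `ω⁺_{2m+3} = ω⁺_{2m+1}·Φ_{p^{2m+2}}(1+T)`). [cite: Washington1997, §13.2] [cite: Pollack2003, §6.5 (display before Prop. 6.18)] -/
theorem exists_deg_pow_mul_invol_cyclotomicOmegaPlus_two_mul_add_one (m : ℕ) :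
    ∃ d : ℕ, (p + 1) * d + p = p ^ (2 * m + 1) ∧
      (1 + PowerSeries.X : PowerSeries ℤ_[p]) ^ d *
          invol p (((cyclotomicOmegaPlus p (2 * m + 1)).map (Int.castRingHom ℤ_[p]) : ℤ_[p][X]) : PowerSeries ℤ_[p]) =
        (((cyclotomicOmegaPlus p (2 * m + 1)).map (Int.castRingHom ℤ_[p]) : ℤ_[p][X]) : PowerSeries ℤ_[p]) := by
  have hP : p.Prime := hp.out
  induction m with
  | zero =>
    refine ⟨0, by simp, ?_⟩
    rw [cyclotomicOmegaPlus_two_mul_add_one, mul_zero, cyclotomicOmegaPlus_zero]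
    simp
  | succ m ih =>
    obtain ⟨d, hd, hι⟩ := ih
    refine ⟨d + (p - 1) * p ^ (2 * m + 1), ?_, ?_⟩
    · have h1 : 1 ≤ p := hP.one_lt.le
      zify [h1] at hd ⊢
      have e : ((p : ℤ)) ^ (2 * (m + 1) + 1) = (p : ℤ) ^ (2 * m + 1) * p * p := by ring
      rw [e]
      linear_combination hd
    · rw [cyclotomicOmegaPlus_two_mul_add_one,
        show 2 * (m + 1) = 2 * m + 2 by ring, cyclotomicOmegaPlus_two_mul_add_two, ← cyclotomicOmegaPlus_two_mul_add_one,
        Polynomial.map_mul, Polynomial.coe_mul, map_mul, pow_add, mul_mul_mul_comm, hι,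
        show 2 * m + 2 = (2 * m + 1) + 1 by ring, pow_mul_invol_cyclotomic_comp_X_add_one]

/-! ## §20 Part V's functional equations of `M^±` with EXPLICIT exponents `s_n + d_n` (`s_n = c mod pⁿ` for ONE `p`-adic `c`) -/

section Explicit

variable {N : ℕ} [NeZero N] {f : CuspForm (Gamma0 N) 2}

/-- **`ι M⁺ − w·(1+T)^{s_{2m} + d_{2m}}·M⁺ ∈ T·ω⁺_{2m}·Λ`** with `s_{2m} = c mod p^{2m}` the discrete logarithm of `⟨N⟩` at level `2m` cut
out of ONE `p`-adic exponent `c` (`N ≡ η_N γ^{c mod pⁿ} (mod p^{n+1})` for all `n`, hypothesis `hc`, shape of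
`exists_teichmuller_exponent_natCast`) and `(p+1)d_{2m} + 1 = p^{2m}`: Part V's `exists_invol_mazurTatePlus_sub_sign_mul_eq` with the
exponent made explicit (same descent, §19's `d`). [cite: MazurTateTeitelbaum1986Invent, §I.17] [cite: Pollack2003, Prop. 6.18] -/
theorem exists_invol_mazurTatePlus_sub_sign_mul_eq_explicit (hp2 : p ≠ 2) (hf0 : IsNewform0 f) (hQ : coeffField f = ⊥)
    (hpN : ¬ p ∣ N) (hap : cuspCoeff f p = ((0 : ℤ) : ℂ)) {σ : ℤ} (hσ : σ ^ 2 = 1)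
    (hW : atkinLehnerInvolution N 2 N f = (-(σ : ℂ)) • f)
    {ηN : rootsOfUnity (torsionOrder p) ℤ_[p]} {c : ℤ_[p]}
    (hc : ∀ n : ℕ, PadicInt.toZModPow (n + cyclotomicExponent p) ((ηN : ℤ_[p]ˣ) : ℤ_[p]) *
      (cyclotomicGenerator p : ZMod (p ^ (n + cyclotomicExponent p))) ^ (PadicInt.toZModPow n c).val =
        (N : ZMod (p ^ (n + cyclotomicExponent p))))
    {M : IwasawaAlgebra p}
    (hM : ∀ m : ℕ, IsCongrModOmega p (2 * m) (quadraticBranchMazurTateElement p f (2 * m))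
      ((-1) ^ (m + 1) * cyclotomicOmegaMinus p (2 * m)) M) (m : ℕ) :
    ∃ (d : ℕ) (G : PowerSeries ℤ_[p]), (p + 1) * d + 1 = p ^ (2 * m) ∧
      invol p M - PowerSeries.C ((σ * legendreSym p (-(N : ℤ)) : ℤ) : ℤ_[p]) *
          (1 + PowerSeries.X) ^ ((PadicInt.toZModPow (2 * m) c).val + d) * M =
        (((X * cyclotomicOmegaPlus p (2 * m)).map (Int.castRingHom ℤ_[p]) : ℤ_[p][X]) : PowerSeries ℤ_[p]) * G := by
  classical
  obtain ⟨Θ, q, hΘ, hid⟩ := EtaMinusCoeffCongruence.exists_sub_eq_omega_mul_of_isCongrModOmega hp2 hf0 hQ hpN hap (hM m)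
  obtain ⟨Θ', q', hΘ', hFE⟩ := exists_lift_invol_sub_sign_mul_eq_omega_mul hp2 hf0 hQ hpN hap hσ hW (2 * m) (hc (2 * m))
  have hΘΘ : Θ' = Θ := Polynomial.map_injective _ (IsFractionRing.injective ℤ_[p] ℚ_[p]) (hΘ'.trans hΘ.symm)
  rw [hΘΘ, sign_eq_mul_legendreSym_neg hp2 hpN (hc (2 * m))] at hFE
  obtain ⟨d, hd, hdι⟩ := exists_deg_pow_mul_invol_cyclotomicOmegaMinus_two_mul (p := p) m
  refine ⟨d, (exists_invol_sub_eq_mul_of_congr (ε := (-1) ^ (m + 1)) (n := p ^ (2 * m)) (q := q) (q' := q')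
    (Θ := (Θ : PowerSeries ℤ_[p]))
    (W := (((cyclotomicOmega p (2 * m)).map (Int.castRingHom ℤ_[p]) : ℤ_[p][X]) : PowerSeries ℤ_[p]))
    (B := (((X * cyclotomicOmegaPlus p (2 * m)).map (Int.castRingHom ℤ_[p]) : ℤ_[p][X]) : PowerSeries ℤ_[p]))
    (M := M) (c := ((σ * legendreSym p (-(N : ℤ)) : ℤ) : ℤ_[p])) (s := (PadicInt.toZModPow (2 * m) c).val) (d := d)
    ?_ ?_ ?_ (invol_cyclotomicOmega (2 * m)) hdι ?_ ?_ ?_).imp fun G hG ↦ ⟨hd, hG⟩⟩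
  · rw [← hid, Polynomial.map_mul, Polynomial.map_pow, Polynomial.map_neg, Polynomial.map_one, Polynomial.coe_mul,
      Polynomial.coe_pow, Polynomial.coe_neg, Polynomial.coe_one]
    ring
  · linear_combination hFE
  · rw [← X_mul_cyclotomicOmegaPlus_mul_cyclotomicOmegaMinus, Polynomial.map_mul, Polynomial.coe_mul]
  · exact fun h ↦ ((monic_cyclotomicOmegaMinus p (2 * m)).map _).ne_zero (Polynomial.coe_eq_zero_iff.mp h)
  · rw [map_pow, map_neg, map_one]
  · rw [← pow_add, ← two_mul, pow_mul, neg_one_sq, one_pow]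

/-- **`ι M⁻ − w·(1+T)^{s_{2m+1} + d_{2m+1}}·M⁻ ∈ T·ω⁻_{2m+1}·Λ`** with `(p+1)d_{2m+1} + p = p^{2m+1}` (minus twin).
[cite: MazurTateTeitelbaum1986Invent, §I.17] [cite: Pollack2003, Prop. 6.18] -/
theorem exists_invol_mazurTateMinus_sub_sign_mul_eq_explicit (hp2 : p ≠ 2) (hf0 : IsNewform0 f) (hQ : coeffField f = ⊥)
    (hpN : ¬ p ∣ N) (hap : cuspCoeff f p = ((0 : ℤ) : ℂ)) {σ : ℤ} (hσ : σ ^ 2 = 1)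
    (hW : atkinLehnerInvolution N 2 N f = (-(σ : ℂ)) • f)
    {ηN : rootsOfUnity (torsionOrder p) ℤ_[p]} {c : ℤ_[p]}
    (hc : ∀ n : ℕ, PadicInt.toZModPow (n + cyclotomicExponent p) ((ηN : ℤ_[p]ˣ) : ℤ_[p]) *
      (cyclotomicGenerator p : ZMod (p ^ (n + cyclotomicExponent p))) ^ (PadicInt.toZModPow n c).val =
        (N : ZMod (p ^ (n + cyclotomicExponent p))))
    {M : IwasawaAlgebra p}
    (hM : ∀ m : ℕ, IsCongrModOmega p (2 * m + 1) (quadraticBranchMazurTateElement p f (2 * m + 1))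
      ((-1) ^ (m + 1) * cyclotomicOmegaPlus p (2 * m + 1)) M) (m : ℕ) :
    ∃ (d : ℕ) (G : PowerSeries ℤ_[p]), (p + 1) * d + p = p ^ (2 * m + 1) ∧
      invol p M - PowerSeries.C ((σ * legendreSym p (-(N : ℤ)) : ℤ) : ℤ_[p]) *
          (1 + PowerSeries.X) ^ ((PadicInt.toZModPow (2 * m + 1) c).val + d) * M =
        (((X * cyclotomicOmegaMinus p (2 * m + 1)).map (Int.castRingHom ℤ_[p]) : ℤ_[p][X]) : PowerSeries ℤ_[p]) * G := by
  classical
  obtain ⟨Θ, q, hΘ, hid⟩ := EtaMinusCoeffCongruence.exists_sub_eq_omega_mul_of_isCongrModOmega hp2 hf0 hQ hpN hap (hM m)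
  obtain ⟨Θ', q', hΘ', hFE⟩ := exists_lift_invol_sub_sign_mul_eq_omega_mul hp2 hf0 hQ hpN hap hσ hW (2 * m + 1) (hc (2 * m + 1))
  have hΘΘ : Θ' = Θ := Polynomial.map_injective _ (IsFractionRing.injective ℤ_[p] ℚ_[p]) (hΘ'.trans hΘ.symm)
  rw [hΘΘ, sign_eq_mul_legendreSym_neg hp2 hpN (hc (2 * m + 1))] at hFE
  obtain ⟨d, hd, hdι⟩ := exists_deg_pow_mul_invol_cyclotomicOmegaPlus_two_mul_add_one (p := p) m
  refine ⟨d, (exists_invol_sub_eq_mul_of_congr (ε := (-1) ^ (m + 1)) (n := p ^ (2 * m + 1)) (q := q) (q' := q')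
    (Θ := (Θ : PowerSeries ℤ_[p]))
    (W := (((cyclotomicOmega p (2 * m + 1)).map (Int.castRingHom ℤ_[p]) : ℤ_[p][X]) : PowerSeries ℤ_[p]))
    (B := (((X * cyclotomicOmegaMinus p (2 * m + 1)).map (Int.castRingHom ℤ_[p]) : ℤ_[p][X]) : PowerSeries ℤ_[p]))
    (M := M) (c := ((σ * legendreSym p (-(N : ℤ)) : ℤ) : ℤ_[p])) (s := (PadicInt.toZModPow (2 * m + 1) c).val) (d := d)
    ?_ ?_ ?_ (invol_cyclotomicOmega (2 * m + 1)) hdι ?_ ?_ ?_).imp fun G hG ↦ ⟨hd, hG⟩⟩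
  · rw [← hid, Polynomial.map_mul, Polynomial.map_pow, Polynomial.map_neg, Polynomial.map_one, Polynomial.coe_mul,
      Polynomial.coe_pow, Polynomial.coe_neg, Polynomial.coe_one]
    ring
  · linear_combination hFE
  · rw [← X_mul_cyclotomicOmegaPlus_mul_cyclotomicOmegaMinus]
    simp only [Polynomial.map_mul, Polynomial.coe_mul]
    ring
  · exact fun h ↦ ((monic_cyclotomicOmegaPlus p (2 * m + 1)).map _).ne_zero (Polynomial.coe_eq_zero_iff.mp h)
  · rw [map_pow, map_neg, map_one]
  · rw [← pow_add, ← two_mul, pow_mul, neg_one_sq, one_pow]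

end Explicit

/-! ## §21 The limit: `p`-adic convergence tools and the generic `Λ`-lemma -/

/-- A sequence in `ℤ_p` whose distance to `a` is eventually `≤ p^{−(m−k)}` converges to `a`. [folklore] -/
theorem tendsto_of_norm_sub_le_pow {x : ℕ → ℤ_[p]} {a : ℤ_[p]} (k : ℕ)
    (h : ∀ m, k ≤ m → ‖x m - a‖ ≤ (p : ℝ) ^ (-((m - k : ℕ) : ℤ))) :
    Tendsto x atTop (𝓝 a) := by
  have hP : p.Prime := hp.out
  rw [Metric.tendsto_atTop]
  intro ε hε
  obtain ⟨n, hn⟩ := PadicInt.exists_pow_neg_lt p hε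
  refine ⟨n + k, fun m hm ↦ ?_⟩
  rw [dist_eq_norm]
  have h1 := h m (by omega)
  have h2 : (p : ℝ) ^ (-((m - k : ℕ) : ℤ)) ≤ (p : ℝ) ^ (-(n : ℤ)) :=
    zpow_le_zpow_right₀ (by exact_mod_cast hP.one_lt.le) (by omega)
  exact lt_of_le_of_lt (h1.trans h2) hn

/-- `p^n ∣ x` in `ℤ_p` gives `‖x‖ ≤ p^{−n}`. [folklore] -/
theorem norm_le_pow_of_pow_dvd {x : ℤ_[p]} {n : ℕ} (h : (p : ℤ_[p]) ^ n ∣ x) :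
    ‖x‖ ≤ (p : ℝ) ^ (-(n : ℤ)) :=
  (PadicInt.norm_le_pow_iff_mem_span_pow x n).mpr (Ideal.mem_span_singleton.mpr h)

/-- `‖p + 1‖_p = 1`: `p + 1` is a `p`-adic unit (`‖p‖ < 1 = ‖1‖`, nonarchimedean). [folklore] -/
theorem norm_natCast_add_one : ‖((p : ℤ_[p]) + 1)‖ = 1 := by
  have hP : p.Prime := hp.out
  have h1 : ‖((p : ℤ_[p]) + 1)‖ ≤ 1 := PadicInt.norm_le_one _
  have h2 : ‖(p : ℤ_[p])‖ < 1 := by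
    rw [PadicInt.norm_p]; exact inv_lt_one_of_one_lt₀ (by exact_mod_cast hP.one_lt)
  by_contra hne
  have hlt : ‖((p : ℤ_[p]) + 1)‖ < 1 := lt_of_le_of_ne h1 hne
  have h3 : ‖(1 : ℤ_[p])‖ < 1 := by
    have h4 := PadicInt.nonarchimedean ((p : ℤ_[p]) + 1) (-(p : ℤ_[p]))
    rw [show ((p : ℤ_[p]) + 1) + -(p : ℤ_[p]) = 1 by ring, norm_neg] at h4
    exact lt_of_le_of_lt h4 (max_lt hlt h2)
  rw [norm_one] at h3
  exact lt_irrefl _ h3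

/-- `j ≤ p^{2j+1}(p−1)` (the range of g26's coefficient lemma always covers the index). [folklore] -/
theorem le_pow_two_mul_add_one_mul_sub_one (j : ℕ) : j ≤ p ^ (2 * j + 1) * (p - 1) := by
  have h2 := hp.out.two_le
  calc j ≤ p ^ j := (Nat.lt_pow_self hp.out.one_lt).le
    _ ≤ p ^ (2 * j + 1) := Nat.pow_le_pow_right (by omega) (by omega)
    _ = p ^ (2 * j + 1) * 1 := (mul_one _).symm
    _ ≤ p ^ (2 * j + 1) * (p - 1) := Nat.mul_le_mul_left _ (by omega)

/-- **The level-`n` discrete logarithm is within `p^{−n}` of the `p`-adic exponent**: `‖(c mod pⁿ) − c‖ ≤ p^{−n}` for the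
representative `(toZModPow n c).val ∈ [0, pⁿ)` (kernel of `toZModPow n` is `pⁿℤ_p`, Mathlib `PadicInt.ker_toZModPow`). [folklore] -/
theorem norm_natCast_val_toZModPow_sub_le (c : ℤ_[p]) (n : ℕ) :
    ‖(((PadicInt.toZModPow n c).val : ℕ) : ℤ_[p]) - c‖ ≤ (p : ℝ) ^ (-(n : ℤ)) := by
  haveI : NeZero (p ^ n) := ⟨pow_ne_zero _ hp.out.ne_zero⟩
  rw [PadicInt.norm_le_pow_iff_mem_span_pow, ← PadicInt.ker_toZModPow, RingHom.mem_ker, map_sub, map_natCast,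
    ZMod.natCast_zmod_val, sub_self]

omit hp in
/-- **The coefficients of `w·(1+T)^z·M` are continuous in the `p`-adic exponent `z`**: `coeff_j = w·Σ_{i+k=j}(z choose i)·M_k`, and
`z ↦ (z choose i)` is continuous on `ℤ_p` (Mahler; Mathlib `PadicInt.continuous_choose`). [folklore] -/
theorem continuous_coeff_C_mul_binomialSeries_mul [Fact p.Prime] (w : ℤ_[p]) (M : PowerSeries ℤ_[p]) (j : ℕ) :
    Continuous fun z : ℤ_[p] ↦
      PowerSeries.coeff j (PowerSeries.C w * PowerSeries.binomialSeries ℤ_[p] z * M) := by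
  have h : (fun z : ℤ_[p] ↦ PowerSeries.coeff j (PowerSeries.C w * PowerSeries.binomialSeries ℤ_[p] z * M)) =
      fun z ↦ w * ∑ x ∈ Finset.HasAntidiagonal.antidiagonal j, Ring.choose z x.1 * PowerSeries.coeff x.2 M := by
    funext z
    rw [mul_assoc, PowerSeries.coeff_C_mul, PowerSeries.coeff_mul]
    simp only [PowerSeries.binomialSeries_coeff, smul_eq_mul, mul_one]
  rw [h]
  exact continuous_const.mul
    (continuous_finsetSum _ fun x _ ↦ (PadicInt.continuous_choose x.1).mul continuous_const)

/-- **THE LIMIT LEMMA.** In `Λ = ℤ_p⟦T⟧`: if `ι M − w·(1+T)^{e_m}·M = D_m` for a sequence of NATURAL exponents `e_m` converging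
`p`-adically to `e ∈ ℤ_p` and remainders `D_m` whose every coefficient tends to `0`, then EXACTLY `ι M = w·(1+T)^e·M`
with the binomial series `(1+T)^e = Σ (e choose i) Tⁱ` (coefficientwise: `coeff_j(ι M) − coeff_j(w(1+T)^{e_m}M) = coeff_j D_m → 0`,
while by continuity the left side tends to `coeff_j(ι M) − coeff_j(w(1+T)^e M)`; limits in `ℤ_p` are unique).
[cite: GreenbergLNM1716, §1 (pp. 67–68: ⟨N⟩^{s−1} = (1+T)^c)] [cite: Washington1997, §7.1] -/
theorem invol_eq_C_mul_binomialSeries_mul_of_tendsto {M : PowerSeries ℤ_[p]} {w e : ℤ_[p]}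
    (es : ℕ → ℕ) (D : ℕ → PowerSeries ℤ_[p])
    (hFE : ∀ m, invol p M - PowerSeries.C w * (1 + PowerSeries.X) ^ (es m) * M = D m)
    (hD : ∀ j : ℕ, Tendsto (fun m ↦ PowerSeries.coeff j (D m)) atTop (𝓝 0))
    (he : Tendsto (fun m ↦ ((es m : ℕ) : ℤ_[p])) atTop (𝓝 e)) :
    invol p M = PowerSeries.C w * PowerSeries.binomialSeries ℤ_[p] e * M := by
  refine sub_eq_zero.mp (PowerSeries.ext fun j ↦ ?_)
  set F : ℤ_[p] → ℤ_[p] := fun z ↦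
    PowerSeries.coeff j (PowerSeries.C w * PowerSeries.binomialSeries ℤ_[p] z * M) with hF
  have hFc : Continuous F := continuous_coeff_C_mul_binomialSeries_mul w M j
  have h1 : ∀ m, PowerSeries.coeff j (invol p M) - F ((es m : ℕ) : ℤ_[p]) = PowerSeries.coeff j (D m) := by
    intro m
    simp only [hF]
    rw [PowerSeries.binomialSeries_nat, ← map_sub, hFE]
  have h2 : Tendsto (fun m ↦ PowerSeries.coeff j (invol p M) - F ((es m : ℕ) : ℤ_[p])) atTop
      (𝓝 (PowerSeries.coeff j (invol p M) - F e)) :=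
    tendsto_const_nhds.sub ((hFc.tendsto e).comp he)
  have h3 : Tendsto (fun m ↦ PowerSeries.coeff j (invol p M) - F ((es m : ℕ) : ℤ_[p])) atTop (𝓝 0) := by
    simp_rw [h1]
    exact hD j
  have h4 : PowerSeries.coeff j (invol p M) - F e = 0 := tendsto_nhds_unique h2 h3
  rw [map_sub, map_zero]
  exact h4

/-! ## §22 THE EXACT FUNCTIONAL EQUATIONS: `ι M⁺ = w(1+T)^{c+b}M⁺`, `ι M⁻ = w(1+T)^{c+a}M⁻`, and for EVERY `L_p^±(V, η, X)` -/

section Exact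

variable {N : ℕ} [NeZero N] {f : CuspForm (Gamma0 N) 2}

omit hp in
/-- The exponent's convergence: `s_n + d_n → c + b` in `ℤ_p` when `‖s_n − c‖ ≤ p^{−n}` and `(p+1)d_n + r = pⁿ`, `(p+1)b = −r`
(`d_n − b = (d_n + …)`: `(p+1)(d_n − b) = pⁿ`, so `‖d_n − b‖ ≤ p^{−n}`; nonarchimedean triangle). [folklore] -/
theorem tendsto_natCast_add_of_level [Fact p.Prime] {c b : ℤ_[p]} {r : ℕ} (hb : ((p : ℤ_[p]) + 1) * b = -(r : ℤ_[p]))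
    (lev : ℕ → ℕ) (hlev : ∀ m, m ≤ lev m) (s d : ℕ → ℕ)
    (hs : ∀ m, ‖((s m : ℕ) : ℤ_[p]) - c‖ ≤ (p : ℝ) ^ (-((lev m : ℕ) : ℤ)))
    (hd : ∀ m, (p + 1) * d m + r = p ^ (lev m)) :
    Tendsto (fun m ↦ ((s m + d m : ℕ) : ℤ_[p])) atTop (𝓝 (c + b)) := by
  have hP : p.Prime := Fact.out
  refine tendsto_of_norm_sub_le_pow 0 fun m _ ↦ ?_
  have hun : ‖((p : ℤ_[p]) + 1)‖ = 1 := norm_natCast_add_one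
  -- `(p+1)(d_m − b) = p^{lev m}`, so `‖d_m − b‖ = p^{−lev m}`
  have hdb : ((p : ℤ_[p]) + 1) * (((d m : ℕ) : ℤ_[p]) - b) = (p : ℤ_[p]) ^ (lev m) := by
    have h := congr_arg (fun n : ℕ ↦ (n : ℤ_[p])) (hd m)
    push_cast at h
    linear_combination h - hb
  have hdn : ‖((d m : ℕ) : ℤ_[p]) - b‖ ≤ (p : ℝ) ^ (-((lev m : ℕ) : ℤ)) := by
    have h5 := congr_arg (fun x : ℤ_[p] ↦ ‖x‖) hdb
    simp only [norm_mul, hun, one_mul, norm_pow, PadicInt.norm_p] at h5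
    exact le_of_eq (by rw [h5, ← zpow_natCast, inv_zpow'])
  have hsum : ((s m + d m : ℕ) : ℤ_[p]) - (c + b) = (((s m : ℕ) : ℤ_[p]) - c) + (((d m : ℕ) : ℤ_[p]) - b) := by
    push_cast; ring
  rw [hsum]
  refine (PadicInt.nonarchimedean _ _).trans (max_le ((hs m).trans ?_) (hdn.trans ?_)) <;>
    exact zpow_le_zpow_right₀ (by exact_mod_cast hP.one_lt.le) (by have := hlev m; omega)

/-- **THE EXACT FUNCTIONAL EQUATION OF THE PLUS MAZUR–TATE LIMIT: `ι M⁺ = w · (1+T)^{c+b} · M⁺`**, `w = σ·(−N | p)`, `(p+1)b = −1`.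
Here `p` is odd, `f` a rational newform of level `N` prime to `p` with `a_p(f) = 0` and Fricke sign `σ` (`w_N f = −σ f`), `c ∈ ℤ_p` the
`p`-adic exponent of `N` (`N = η_N γ^c`: `hc`, provided by `exists_teichmuller_exponent_natCast`), `M ∈ Λ` the plus limit
(`θ_{2m}(η) ≡ (−1)^{m+1}ω⁻_{2m}M (mod ω_{2m})` for all `m`), and `(1+T)^{c+b} = PowerSeries.binomialSeries ℤ_[p] (c + b)`. This is the
η-branch twin of Sprung's Cor. 4.14 for `L♭` (`W⁻ = (1+T)^{1/(p+1)}`; Kobayashi's `+` is Pollack's `−`), i.e. the exact form of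
Mazur–Tate–Teitelbaum's §I.17 on the quadratic branch; proved by §20 and the limit lemma of §21.
[cite: Sprung2017, Cor. 4.14 (a_p = 0 display) and §3.5 (W⁻)] [cite: MazurTateTeitelbaum1986Invent, §I.17]
[cite: Pollack2003, Thm. 5.13 (statement corrected by Sprung)] -/
theorem invol_mazurTatePlus_eq (hp2 : p ≠ 2) (hf0 : IsNewform0 f) (hQ : coeffField f = ⊥)
    (hpN : ¬ p ∣ N) (hap : cuspCoeff f p = ((0 : ℤ) : ℂ)) {σ : ℤ} (hσ : σ ^ 2 = 1)
    (hW : atkinLehnerInvolution N 2 N f = (-(σ : ℂ)) • f)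
    {ηN : rootsOfUnity (torsionOrder p) ℤ_[p]} {c : ℤ_[p]}
    (hc : ∀ n : ℕ, PadicInt.toZModPow (n + cyclotomicExponent p) ((ηN : ℤ_[p]ˣ) : ℤ_[p]) *
      (cyclotomicGenerator p : ZMod (p ^ (n + cyclotomicExponent p))) ^ (PadicInt.toZModPow n c).val =
        (N : ZMod (p ^ (n + cyclotomicExponent p))))
    {b : ℤ_[p]} (hb : ((p : ℤ_[p]) + 1) * b = -1)
    {M : IwasawaAlgebra p}
    (hM : ∀ m : ℕ, IsCongrModOmega p (2 * m) (quadraticBranchMazurTateElement p f (2 * m))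
      ((-1) ^ (m + 1) * cyclotomicOmegaMinus p (2 * m)) M) :
    invol p M = PowerSeries.C ((σ * legendreSym p (-(N : ℤ)) : ℤ) : ℤ_[p]) *
      PowerSeries.binomialSeries ℤ_[p] (c + b) * M := by
  have hP : p.Prime := hp.out
  choose d G hd hG using exists_invol_mazurTatePlus_sub_sign_mul_eq_explicit hp2 hf0 hQ hpN hap hσ hW hc hM
  refine invol_eq_C_mul_binomialSeries_mul_of_tendsto (fun m ↦ (PadicInt.toZModPow (2 * m) c).val + d m)
    (fun m ↦ (((X * cyclotomicOmegaPlus p (2 * m)).map (Int.castRingHom ℤ_[p]) : ℤ_[p][X]) : PowerSeries ℤ_[p]) * G m)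
    hG (fun j ↦ ?_) ?_
  · -- `coeff_j (T·ω⁺_{2m}·G_m) ∈ p^{m−j} ℤ_p`
    refine tendsto_of_norm_sub_le_pow j fun m hm ↦ ?_
    simp only [sub_zero]
    exact norm_le_pow_of_pow_dvd (EtaPlusCoeffCongruence.pow_dvd_coeff_X_mul_cyclotomicOmegaPlus_mul_of_le m j hm (G m)
      (le_pow_two_mul_add_one_mul_sub_one j))
  · exact tendsto_natCast_add_of_level (r := 1) (by rw [hb, Nat.cast_one]) (fun m ↦ 2 * m) (fun m ↦ by omega)
      (fun m ↦ (PadicInt.toZModPow (2 * m) c).val) d (fun m ↦ norm_natCast_val_toZModPow_sub_le c (2 * m)) hd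

/-- **THE EXACT FUNCTIONAL EQUATION OF THE MINUS MAZUR–TATE LIMIT: `ι M⁻ = w · (1+T)^{c+a} · M⁻`**, `(p+1)a = −p`
(`θ_{2m+1}(η) ≡ (−1)^{m+1}ω⁺_{2m+1}M (mod ω_{2m+1})` for all `m`; the η-branch twin of Sprung's Cor. 4.14 for `L♯`, `W⁺ = (1+T)^{p/(p+1)}`).
[cite: Sprung2017, Cor. 4.14 (a_p = 0 display) and §3.5 (W⁺)] [cite: MazurTateTeitelbaum1986Invent, §I.17]
[cite: Pollack2003, Thm. 5.13 (statement corrected by Sprung)] -/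
theorem invol_mazurTateMinus_eq (hp2 : p ≠ 2) (hf0 : IsNewform0 f) (hQ : coeffField f = ⊥)
    (hpN : ¬ p ∣ N) (hap : cuspCoeff f p = ((0 : ℤ) : ℂ)) {σ : ℤ} (hσ : σ ^ 2 = 1)
    (hW : atkinLehnerInvolution N 2 N f = (-(σ : ℂ)) • f)
    {ηN : rootsOfUnity (torsionOrder p) ℤ_[p]} {c : ℤ_[p]}
    (hc : ∀ n : ℕ, PadicInt.toZModPow (n + cyclotomicExponent p) ((ηN : ℤ_[p]ˣ) : ℤ_[p]) *
      (cyclotomicGenerator p : ZMod (p ^ (n + cyclotomicExponent p))) ^ (PadicInt.toZModPow n c).val =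
        (N : ZMod (p ^ (n + cyclotomicExponent p))))
    {a : ℤ_[p]} (ha : ((p : ℤ_[p]) + 1) * a = -(p : ℤ_[p]))
    {M : IwasawaAlgebra p}
    (hM : ∀ m : ℕ, IsCongrModOmega p (2 * m + 1) (quadraticBranchMazurTateElement p f (2 * m + 1))
      ((-1) ^ (m + 1) * cyclotomicOmegaPlus p (2 * m + 1)) M) :
    invol p M = PowerSeries.C ((σ * legendreSym p (-(N : ℤ)) : ℤ) : ℤ_[p]) *
      PowerSeries.binomialSeries ℤ_[p] (c + a) * M := by
  have hP : p.Prime := hp.out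
  choose d G hd hG using exists_invol_mazurTateMinus_sub_sign_mul_eq_explicit hp2 hf0 hQ hpN hap hσ hW hc hM
  refine invol_eq_C_mul_binomialSeries_mul_of_tendsto (fun m ↦ (PadicInt.toZModPow (2 * m + 1) c).val + d m)
    (fun m ↦ (((X * cyclotomicOmegaMinus p (2 * m + 1)).map (Int.castRingHom ℤ_[p]) : ℤ_[p][X]) : PowerSeries ℤ_[p]) * G m)
    hG (fun j ↦ ?_) ?_
  · refine tendsto_of_norm_sub_le_pow j fun m hm ↦ ?_
    simp only [sub_zero]
    exact norm_le_pow_of_pow_dvd (pow_dvd_coeff_X_mul_cyclotomicOmegaMinus_mul_of_le m j hm (G m)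
      (le_pow_two_mul_add_one_mul_sub_one j))
  · exact tendsto_natCast_add_of_level (r := p) (by rw [ha]) (fun m ↦ 2 * m + 1) (fun m ↦ by omega)
      (fun m ↦ (PadicInt.toZModPow (2 * m + 1) c).val) d (fun m ↦ norm_natCast_val_toZModPow_sub_le c (2 * m + 1)) hd

end Exact

end Summit.BirchSwinnertonDyer.BirchSwinnertonDyer.Theorems.EtaThetaFunctionalEquation

end
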